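import Summits.ValiantsHypothesis.ValiantsHypothesis.Theses.DivisionGap
import Summits.ValiantsHypothesis.ValiantsHypothesis.Theorems.HubHub
import Literature.Computability.AlgebraicComplexity.ValiantClasses
import Literature.Computability.AlgebraicComplexity.ValiantConjectureProofs

/-!
# ValiantsHypothesis / DivisionGap — `PerNotVPToVH` (hub glue)

Route `DivisionGap`, item `stmt-ValiantsHypothesis-5073` (support, rank 9; the same statement is
item #9 of route `BinomialElusive`): if the permanent family `(per_n)_n` over `ℂ` is not a `VP`
family (in the unbundled `IsVPFamily` form), then Valiant's hypothesis `VP_ℂ ≠ VNP_ℂ` holds.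

Pure bookkeeping from three tree results:

* the hub lemma `Summit.ValiantsHypothesis.Hub.valiantsHypothesis_of_not_isVPFamily_per`
  (`Theorems/HubHub.lean`, item `stmt-ValiantsHypothesis-0317`);
* the renaming bridge `Literature.Computability.AlgebraicComplexity.mem_VP_ofFintype_iff_holds`
  (`perFamily ℂ ∈ VP ℂ ↔ IsVPFamily (fun n => perPoly (Fin n) ℂ)`; Bürgisser 2000, Rem. 2.2);
* Valiant's theorem `per ∈ VNP`, discharged as
  `Literature.Computability.AlgebraicComplexity.perFamily_mem_VNP_holds ℂ` (Valiant 1979;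
  Bürgisser 2000, Thm. 2.10).

Nothing else is here.
-/

namespace Summit.ValiantsHypothesis.Theorems

/-- Settles `stmt-ValiantsHypothesis-5073` (`PerNotVPToVH`, route `DivisionGap`):
`¬ IsVPFamily_ℂ (per_n) → ValiantsHypothesis`. If `VP ℂ = VNP ℂ` then `perFamily ℂ ∈ VNP ℂ = VP ℂ`
(Valiant 1979), and the renaming bridge (Bürgisser 2000, Rem. 2.2) turns this into
`IsVPFamily (fun n => perPoly (Fin n) ℂ)`, contradicting the hypothesis. [folklore] -/
theorem perNotVPToVH_proof :
    Summit.ValiantsHypothesis.ValiantsHypothesis.Theses.DivisionGap.PerNotVPToVH := by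
  unfold Summit.ValiantsHypothesis.ValiantsHypothesis.Theses.DivisionGap.PerNotVPToVH
  intro h
  exact Summit.ValiantsHypothesis.Hub.valiantsHypothesis_of_not_isVPFamily_per h
    (Literature.Computability.AlgebraicComplexity.mem_VP_ofFintype_iff_holds _)
    (Literature.Computability.AlgebraicComplexity.perFamily_mem_VNP_holds ℂ)

end Summit.ValiantsHypothesis.Theorems
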